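import Mathlib
import HarnessLib

/-!
# Smooth implicit function theorem with uniqueness, local smoothness hypothesis

Topic `Literature/Analysis/Calculus` (namespace `Literature.Analysis.Calculus`). This module
generalises `exists_smooth_implicitFunction` (`SmoothImplicitFunction.lean`) from a GLOBAL
`C^∞` hypothesis on `G : X × Y → Z` (`X, Y, Z` real Banach spaces) to smoothness on a
neighbourhood `U ∈ 𝓝 (x₀, y₀)` of the base point only (`ContDiffOn ℝ ∞ G U`), which is the form
needed when the nonlinear map is only defined (or only smooth) on chart domains: given
`G (x₀, y₀) = 0` and `D₂G(x₀, y₀) = DG(x₀, y₀) ∘ inr = L : Y ≃L[ℝ] Z` a linear homeomorphism,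
there are radii `ε, δ > 0` and `γ : X → Y`, `C^∞` on `B(x₀, ε)`, with `γ x₀ = y₀`,
`γ(B(x₀, ε)) ⊆ B(y₀, δ)`, `G (x, γ x) = 0` on `B(x₀, ε)`, and UNIQUENESS of the zeros of `G` in
`B(x₀, ε) × B(y₀, δ)` (`exists_smooth_implicitFunction_of_contDiffOn`). Variants: smoothness
given pointwise on an open set (`exists_smooth_implicitFunction_of_contDiffAt`) and on a ball
(`exists_smooth_implicitFunction_of_contDiffOn_ball`); the primed versions
(`exists_smooth_implicitFunction_of_contDiffOn'`, `…_of_contDiffAt'`, `…_of_contDiffOn_ball'`)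
add the localisation `ball x₀ ε ×ˢ ball y₀ δ ⊆ U` of the box and the DERIVATIVE of the
implicit function at the base point, `Dγ(x₀) = -L⁻¹ ∘ D₁G(x₀, y₀)` (`D₁G = DG ∘ inl`), obtained
by implicit differentiation of `G (x, γ x) = 0`
(`comp_inl_add_comp_inr_comp_eq_zero_of_eventually_eq`, `hasFDerivAt_implicit_of_eventually_eq`,
stated for level sets `G (x, γ x) = c`); `exists_smooth_implicitFunction_hasFDerivAt` is the
global-hypothesis theorem with the derivative conclusion added.

Proof of the main theorem: as in the global case, the inverse function theorem
(`HasStrictFDerivAt.toOpenPartialHomeomorph`) for `Φ (x, y) = (x, G (x, y))`, whose derivative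
at `(x₀, y₀)` is the block-triangular isomorphism `(ξ, η) ↦ (ξ, D₁G ξ + L η)`, and
`γ x = (Φ⁻¹ (x, 0)).2`; smoothness of `γ` on a whole ball uses
`OpenPartialHomeomorph.contDiffAt_symm` at every point of a neighbourhood of `(x₀, 0)` whose
preimage lies in the open set `V ⊆ interior U` on which `DΦ` stays invertible
(`ContinuousLinearEquiv.isOpen`, continuity of `DΦ` on the open set `interior U`). Mathlib has
the germ statements only (`ContDiffAt.implicitFunction`,
`HasStrictFDerivAt.implicitFunctionOfProdDomain`). Everything is proved; no geometry.

## References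

* J. Dieudonné, *Foundations of Modern Analysis*, Academic Press 1960, Ch. X §2,
  (10.2.1)–(10.2.3). [Dieudonne1960]
* S. Lang, *Real and Functional Analysis*, Ch. XIV §2 (implicit mapping theorem). [folklore]
-/

noncomputable section

open Set Filter Metric
open scoped Topology ContDiff

namespace Literature.Analysis.Calculus

/-! ### Implicit differentiation -/

/-- **Implicit differentiation.** If `G (x, γ x) = c` for all `x` near `x₀`, `G` has derivative
`f'` at `(x₀, γ x₀)` and `γ` has derivative `γ'` at `x₀`, then `D₁G + D₂G ∘ γ' = 0`, where
`D₁G = f' ∘ inl` and `D₂G = f' ∘ inr` are the partial derivatives (chain rule applied to the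
eventually constant composite `x ↦ G (x, γ x)`). [folklore] -/
theorem comp_inl_add_comp_inr_comp_eq_zero_of_eventually_eq {X Y Z : Type*}
    [NormedAddCommGroup X] [NormedSpace ℝ X] [NormedAddCommGroup Y] [NormedSpace ℝ Y]
    [NormedAddCommGroup Z] [NormedSpace ℝ Z]
    {G : X × Y → Z} {γ : X → Y} {x₀ : X} {c : Z} {f' : X × Y →L[ℝ] Z} {γ' : X →L[ℝ] Y}
    (hG : HasFDerivAt G f' (x₀, γ x₀)) (hγ : HasFDerivAt γ γ' x₀)
    (hc : ∀ᶠ x in 𝓝 x₀, G (x, γ x) = c) :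
    f'.comp (ContinuousLinearMap.inl ℝ X Y) +
      (f'.comp (ContinuousLinearMap.inr ℝ X Y)).comp γ' = 0 := by
  -- the composite `x ↦ G (x, γ x)` has derivative `f' ∘ (id, γ')` and is eventually constant
  have h1 : HasFDerivAt (fun x ↦ G (x, γ x)) (f'.comp ((ContinuousLinearMap.id ℝ X).prod γ'))
      x₀ := hG.comp x₀ ((hasFDerivAt_id x₀).prodMk hγ)
  have h2 : HasFDerivAt (fun x ↦ G (x, γ x)) (0 : X →L[ℝ] Z) x₀ :=
    (hasFDerivAt_const c x₀).congr_of_eventuallyEq hc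
  have h3 := h1.unique h2
  ext v
  have h4 : f' (v, γ' v) = 0 := by
    simpa using congrArg (fun T : X →L[ℝ] Z ↦ T v) h3
  rw [← f'.comp_inl_add_comp_inr (v, γ' v)] at h4
  simpa using h4

/-- **Derivative of an implicit function.** If `G (x, γ x) = c` for all `x` near `x₀`, `G` has
derivative `f'` at `(x₀, γ x₀)` whose second partial `f' ∘ inr` is a linear homeomorphism
`L : Y ≃L[ℝ] Z`, and `γ` is differentiable at `x₀`, then `Dγ(x₀) = -L⁻¹ ∘ D₁G`, i.e. `γ` has
derivative `-(L.symm) ∘L (f' ∘ inl)` at `x₀`.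
[cite: Dieudonne1960, Ch. X §2 (10.2.1)–(10.2.3)] -/
theorem hasFDerivAt_implicit_of_eventually_eq {X Y Z : Type*}
    [NormedAddCommGroup X] [NormedSpace ℝ X] [NormedAddCommGroup Y] [NormedSpace ℝ Y]
    [NormedAddCommGroup Z] [NormedSpace ℝ Z]
    {G : X × Y → Z} {γ : X → Y} {x₀ : X} {c : Z} {f' : X × Y →L[ℝ] Z} (L : Y ≃L[ℝ] Z)
    (hG : HasFDerivAt G f' (x₀, γ x₀)) (hγ : DifferentiableAt ℝ γ x₀)
    (hL : f'.comp (ContinuousLinearMap.inr ℝ X Y) = (L : Y →L[ℝ] Z))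
    (hc : ∀ᶠ x in 𝓝 x₀, G (x, γ x) = c) :
    HasFDerivAt γ (-(L.symm : Z →L[ℝ] Y) ∘L (f'.comp (ContinuousLinearMap.inl ℝ X Y))) x₀ := by
  have hγ' := hγ.hasFDerivAt
  have h := comp_inl_add_comp_inr_comp_eq_zero_of_eventually_eq hG hγ' hc
  rw [hL] at h
  convert hγ' using 1
  ext v
  have hv : f' (v, 0) + L (fderiv ℝ γ x₀ v) = 0 := by
    simpa using congrArg (fun T : X →L[ℝ] Z ↦ T v) h
  have hv2 : L (fderiv ℝ γ x₀ v) = -(f' (v, 0)) := eq_neg_of_add_eq_zero_right hv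
  have hv3 : fderiv ℝ γ x₀ v = -(L.symm (f' (v, 0))) := by
    simpa using congrArg L.symm hv2
  simp [hv3]

/-! ### The implicit function theorem under a local smoothness hypothesis -/

/-- **Smooth implicit function theorem with uniqueness, local smoothness hypothesis (full
form).** Let `X, Y, Z` be real Banach spaces, `G : X × Y → Z` of class `C^∞` on a neighbourhood
`U` of `(x₀, y₀)`, `G (x₀, y₀) = 0`, and assume the partial derivative of `G` in the second
variable at `(x₀, y₀)`, i.e. `DG(x₀, y₀) ∘ inr`, is a linear homeomorphism `L : Y ≃L[ℝ] Z`. Then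
there are `ε > 0`, `δ > 0` and `γ : X → Y` with: `γ` is `C^∞` on `ball x₀ ε`, `γ x₀ = y₀`,
`γ x ∈ ball y₀ δ` and `G (x, γ x) = 0` for `x ∈ ball x₀ ε`, every zero `(x, y)` of `G` with
`x ∈ ball x₀ ε`, `y ∈ ball y₀ δ` satisfies `y = γ x`, the box `ball x₀ ε ×ˢ ball y₀ δ` lies in
`U`, and `γ` has derivative `Dγ(x₀) = -L⁻¹ ∘ D₁G(x₀, y₀)` at the base point, where
`D₁G(x₀, y₀) = DG(x₀, y₀) ∘ inl` (implicit differentiation of `G (x, γ x) = 0`: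
`D₁G + L ∘ Dγ(x₀) = 0`). The version without the last two conclusions is
`exists_smooth_implicitFunction_of_contDiffOn`.
[cite: Dieudonne1960, Ch. X §2 (10.2.1)–(10.2.3)] -/
theorem exists_smooth_implicitFunction_of_contDiffOn' {X Y Z : Type*} [NormedAddCommGroup X]
    [NormedSpace ℝ X] [CompleteSpace X]
    [NormedAddCommGroup Y] [NormedSpace ℝ Y] [CompleteSpace Y]
    [NormedAddCommGroup Z] [NormedSpace ℝ Z] [CompleteSpace Z]
    (G : X × Y → Z) (x₀ : X) (y₀ : Y) (U : Set (X × Y)) (hU : U ∈ 𝓝 (x₀, y₀))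
    (hG : ContDiffOn ℝ ∞ G U) (h0 : G (x₀, y₀) = 0) (L : Y ≃L[ℝ] Z)
    (hL : (fderiv ℝ G (x₀, y₀)).comp (ContinuousLinearMap.inr ℝ X Y) = (L : Y →L[ℝ] Z)) :
    ∃ ε > (0 : ℝ), ∃ δ > (0 : ℝ), ∃ γ : X → Y, ContDiffOn ℝ ∞ γ (Metric.ball x₀ ε) ∧ γ x₀ = y₀ ∧
      (∀ x ∈ Metric.ball x₀ ε, γ x ∈ Metric.ball y₀ δ) ∧
      (∀ x ∈ Metric.ball x₀ ε, G (x, γ x) = 0) ∧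
      (∀ x ∈ Metric.ball x₀ ε, ∀ y ∈ Metric.ball y₀ δ, G (x, y) = 0 → y = γ x) ∧
      Metric.ball x₀ ε ×ˢ Metric.ball y₀ δ ⊆ U ∧
      HasFDerivAt γ (-(L.symm : Z →L[ℝ] Y) ∘L
        ((fderiv ℝ G (x₀, y₀)).comp (ContinuousLinearMap.inl ℝ X Y))) x₀ := by
  have htop : (∞ : WithTop ℕ∞) ≠ 0 := by simp
  -- the derivative at `x₀` follows from the other conclusions by implicit differentiation
  suffices h : ∃ ε > (0 : ℝ), ∃ δ > (0 : ℝ), ∃ γ : X → Y, ContDiffOn ℝ ∞ γ (ball x₀ ε) ∧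
      γ x₀ = y₀ ∧ (∀ x ∈ ball x₀ ε, γ x ∈ ball y₀ δ) ∧ (∀ x ∈ ball x₀ ε, G (x, γ x) = 0) ∧
      (∀ x ∈ ball x₀ ε, ∀ y ∈ ball y₀ δ, G (x, y) = 0 → y = γ x) ∧
      ball x₀ ε ×ˢ ball y₀ δ ⊆ U by
    obtain ⟨ε, hε, δ, hδ, γ, hγs, hγ₀, hγδ, hγz, hγu, hsub⟩ := h
    refine ⟨ε, hε, δ, hδ, γ, hγs, hγ₀, hγδ, hγz, hγu, hsub, ?_⟩
    have hballn : ball x₀ ε ∈ 𝓝 x₀ := ball_mem_nhds x₀ hε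
    have hγd : DifferentiableAt ℝ γ x₀ := (hγs.contDiffAt hballn).differentiableAt htop
    have hGd : HasFDerivAt G (fderiv ℝ G (x₀, y₀)) (x₀, γ x₀) := by
      rw [hγ₀]
      exact ((hG.contDiffAt hU).differentiableAt htop).hasFDerivAt
    have hc : ∀ᶠ x in 𝓝 x₀, G (x, γ x) = 0 := Filter.mem_of_superset hballn hγz
    exact hasFDerivAt_implicit_of_eventually_eq L hGd hγd hL hc
  -- the open neighbourhood `U' = interior U` of the base point on which `G` is smooth
  set U' : Set (X × Y) := interior U with hU'
  have hU'o : IsOpen U' := isOpen_interior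
  have hp₀U' : ((x₀, y₀) : X × Y) ∈ U' := mem_interior_iff_mem_nhds.2 hU
  have hG' : ContDiffOn ℝ ∞ G U' := hG.mono interior_subset
  have hGat : ∀ q ∈ U', ContDiffAt ℝ ∞ G q := fun q hq ↦ hG'.contDiffAt (hU'o.mem_nhds hq)
  -- the derivative of `G` at the base point and its first partial derivative
  set f' : X × Y →L[ℝ] Z := fderiv ℝ G (x₀, y₀) with hf'
  set D₁ : X →L[ℝ] Z := f'.comp (ContinuousLinearMap.inl ℝ X Y) with hD₁
  have hf'_apply : ∀ q : X × Y, f' q = D₁ q.1 + L q.2 := fun q ↦ by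
    have h := f'.comp_inl_add_comp_inr q
    rw [hL] at h
    exact h.symm
  -- `Φ (x, y) = (x, G (x, y))`, its derivative `Φ'` at `(x₀, y₀)` and the inverse `M` of `Φ'`
  set Φ : X × Y → X × Z := fun q ↦ (q.1, G q) with hΦ
  set Φ' : X × Y →L[ℝ] X × Z := (ContinuousLinearMap.fst ℝ X Y).prod f' with hΦ'
  set M : X × Z →L[ℝ] X × Y := (ContinuousLinearMap.fst ℝ X Z).prod
    ((L.symm : Z →L[ℝ] Y).comp
      (ContinuousLinearMap.snd ℝ X Z - D₁.comp (ContinuousLinearMap.fst ℝ X Z))) with hM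
  have hΦ'_apply : ∀ q : X × Y, Φ' q = (q.1, D₁ q.1 + L q.2) := fun q ↦ by
    simp [hΦ', hf'_apply]
  have hM_apply : ∀ q : X × Z, M q = (q.1, L.symm (q.2 - D₁ q.1)) := fun q ↦ by
    simp [hM]
  have hleft : Function.LeftInverse M Φ' := fun q ↦ by
    rw [hΦ'_apply, hM_apply]
    ext <;> simp
  have hright : Function.RightInverse M Φ' := fun q ↦ by
    rw [hM_apply, hΦ'_apply]
    ext <;> simp
  set N : (X × Y) ≃L[ℝ] (X × Z) := ContinuousLinearEquiv.equivOfInverse Φ' M hleft hright with hN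
  -- smoothness of `Φ` on `U'` and strict differentiability of `Φ` at the base point
  have hΦc : ContDiffOn ℝ ∞ Φ U' := contDiffOn_fst.prodMk hG'
  have hΦat : ∀ q ∈ U', ContDiffAt ℝ ∞ Φ q := fun q hq ↦ hΦc.contDiffAt (hU'o.mem_nhds hq)
  have hGd : HasStrictFDerivAt G f' (x₀, y₀) := (hGat _ hp₀U').hasStrictFDerivAt htop
  have hΦs : HasStrictFDerivAt Φ (N : X × Y →L[ℝ] X × Z) (x₀, y₀) := by
    have h : HasStrictFDerivAt Φ Φ' (x₀, y₀) := hasStrictFDerivAt_fst.prodMk hGd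
    exact h
  -- the local inverse
  set e : OpenPartialHomeomorph (X × Y) (X × Z) := hΦs.toOpenPartialHomeomorph Φ with he
  have he_coe : (e : X × Y → X × Z) = Φ := rfl
  have hp₀e : ((x₀, y₀) : X × Y) ∈ e.source := hΦs.mem_toOpenPartialHomeomorph_source
  have hΦp₀ : Φ (x₀, y₀) = (x₀, 0) := by simp [hΦ, h0]
  have hx₀e : ((x₀, (0 : Z)) : X × Z) ∈ e.target := by
    rw [← hΦp₀]; exact hΦs.image_mem_toOpenPartialHomeomorph_target
  have hsymm₀ : e.symm (x₀, 0) = (x₀, y₀) := by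
    rw [← hΦp₀, ← he_coe]; exact e.left_inv hp₀e
  -- `DΦ` is invertible on an open neighbourhood `V ⊆ U'` of `(x₀, y₀)`
  set V : Set (X × Y) := U' ∩ fderiv ℝ Φ ⁻¹'
    range ((↑) : ((X × Y) ≃L[ℝ] (X × Z)) → X × Y →L[ℝ] X × Z) with hV
  have hVo : IsOpen V :=
    (hΦc.continuousOn_fderiv_of_isOpen hU'o (by simp)).isOpen_inter_preimage hU'o
      ContinuousLinearEquiv.isOpen
  have hp₀V : ((x₀, y₀) : X × Y) ∈ V := by
    refine ⟨hp₀U', ?_⟩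
    rw [mem_preimage, hΦs.hasFDerivAt.fderiv]
    exact mem_range_self N
  have hVn : V ∈ 𝓝 (x₀, y₀) := hVo.mem_nhds hp₀V
  obtain ⟨δ, hδ, hballδ⟩ : ∃ δ > 0, ball (x₀, y₀) δ ⊆ e.source ∩ V :=
    Metric.mem_nhds_iff.1 (Filter.inter_mem (e.open_source.mem_nhds hp₀e) hVn)
  -- the open set `W ∋ (x₀, 0)` of points of the target whose preimage lies in `ball (x₀, y₀) δ`
  set W : Set (X × Z) := e.target ∩ e.symm ⁻¹' ball (x₀, y₀) δ with hW
  have hWo : IsOpen W := e.isOpen_inter_preimage_symm isOpen_ball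
  have hx₀W : ((x₀, (0 : Z)) : X × Z) ∈ W := by
    refine ⟨hx₀e, ?_⟩
    rw [mem_preimage, hsymm₀]
    exact mem_ball_self hδ
  have hι : Continuous fun x : X ↦ ((x, (0 : Z)) : X × Z) := continuous_id.prodMk continuous_const
  obtain ⟨ε₁, hε₁, hballε₁⟩ : ∃ ε₁ > 0, ball x₀ ε₁ ⊆ (fun x : X ↦ ((x, (0 : Z)) : X × Z)) ⁻¹' W :=
    Metric.mem_nhds_iff.1 ((hWo.preimage hι).mem_nhds hx₀W)
  -- the implicit function
  set γ : X → Y := fun x ↦ (e.symm (x, 0)).2 with hγ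
  have hWx : ∀ x ∈ ball x₀ (min ε₁ δ), ((x, (0 : Z)) : X × Z) ∈ W := fun x hx ↦
    hballε₁ (ball_subset_ball (min_le_left _ _) hx)
  -- for `(x, 0) ∈ W`: `e.symm (x, 0) = (x, γ x)` and `G (x, γ x) = 0`
  have hpair : ∀ x : X, ((x, (0 : Z)) : X × Z) ∈ W →
      e.symm (x, 0) = (x, γ x) ∧ G (x, γ x) = 0 := by
    intro x hx
    have hr : Φ (e.symm (x, 0)) = (x, 0) := by rw [← he_coe]; exact e.right_inv hx.1
    have h1 : (e.symm (x, 0)).1 = x := by simpa [hΦ] using congrArg Prod.fst hr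
    have h2 : G (e.symm (x, 0)) = 0 := by simpa [hΦ] using congrArg Prod.snd hr
    have hq : e.symm (x, 0) = (x, γ x) := Prod.ext h1 rfl
    exact ⟨hq, by rw [← hq]; exact h2⟩
  refine ⟨min ε₁ δ, lt_min hε₁ hδ, δ, hδ, γ, ?_, ?_, ?_, ?_, ?_, ?_⟩
  · -- smoothness on the ball
    intro x hx
    have hxW := hWx x hx
    have hqV : e.symm (x, 0) ∈ V := (hballδ hxW.2).2
    obtain ⟨hqU', N', hN'⟩ := hqV
    have hderiv : HasFDerivAt e (N' : X × Y →L[ℝ] X × Z) (e.symm (x, 0)) := by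
      rw [hN', he_coe]
      exact ((hΦat _ hqU').differentiableAt htop).hasFDerivAt
    have hsymm : ContDiffAt ℝ ∞ e.symm (x, 0) :=
      e.contDiffAt_symm hxW.1 hderiv (hΦat _ hqU')
    have hcomp : ContDiffAt ℝ ∞ (fun x : X ↦ (e.symm (x, 0)).2) x :=
      contDiffAt_snd.comp x (hsymm.comp x (contDiffAt_id.prodMk contDiffAt_const))
    exact hcomp.contDiffWithinAt
  · -- value at `x₀`
    simp only [hγ]
    rw [hsymm₀]
  · -- values in `ball y₀ δ`
    intro x hx
    have hxW := hWx x hx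
    have hq : e.symm (x, 0) ∈ ball (x₀, y₀) δ := hxW.2
    rw [mem_ball, Prod.dist_eq] at hq
    exact mem_ball.2 (lt_of_le_of_lt (le_max_right _ _) hq)
  · -- zeros
    intro x hx
    exact (hpair x (hWx x hx)).2
  · -- uniqueness
    intro x hx y hy hxy
    have hxyb : ((x, y) : X × Y) ∈ ball (x₀, y₀) δ := by
      rw [mem_ball, Prod.dist_eq, max_lt_iff]
      exact ⟨(mem_ball.1 hx).trans_le (min_le_right _ _), mem_ball.1 hy⟩
    have hsrc : ((x, y) : X × Y) ∈ e.source := (hballδ hxyb).1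
    have hl : e.symm (Φ (x, y)) = (x, y) := by rw [← he_coe]; exact e.left_inv hsrc
    have hΦxy : Φ (x, y) = (x, 0) := by simp [hΦ, hxy]
    rw [hΦxy] at hl
    simp only [hγ]
    rw [hl]
  · -- the box lies in `U`
    rintro ⟨x, y⟩ ⟨hx, hy⟩
    have hxyb : ((x, y) : X × Y) ∈ ball (x₀, y₀) δ := by
      rw [mem_ball, Prod.dist_eq, max_lt_iff]
      exact ⟨(mem_ball.1 hx).trans_le (min_le_right _ _), mem_ball.1 hy⟩
    exact interior_subset (hballδ hxyb).2.1

/-- **Smooth implicit function theorem with uniqueness, local smoothness hypothesis.** Let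
`X, Y, Z` be real Banach spaces, `G : X × Y → Z` of class `C^∞` on a neighbourhood `U` of
`(x₀, y₀)`, `G (x₀, y₀) = 0`, and assume the partial derivative of `G` in the second variable at
`(x₀, y₀)`, i.e. `DG(x₀, y₀) ∘ inr`, is a linear homeomorphism `L : Y ≃L[ℝ] Z`. Then there are
`ε > 0`, `δ > 0` and `γ : X → Y` with: `γ` is `C^∞` on `ball x₀ ε`, `γ x₀ = y₀`,
`γ x ∈ ball y₀ δ` and `G (x, γ x) = 0` for `x ∈ ball x₀ ε`, and every zero `(x, y)` of `G` with
`x ∈ ball x₀ ε`, `y ∈ ball y₀ δ` satisfies `y = γ x`. (The full form, with the localisation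
`ball x₀ ε ×ˢ ball y₀ δ ⊆ U` and the derivative of `γ` at `x₀`, is
`exists_smooth_implicitFunction_of_contDiffOn'`; the global-hypothesis version is
`exists_smooth_implicitFunction`.)
[cite: Dieudonne1960, Ch. X §2 (10.2.1)–(10.2.3)] -/
theorem exists_smooth_implicitFunction_of_contDiffOn {X Y Z : Type*} [NormedAddCommGroup X]
    [NormedSpace ℝ X] [CompleteSpace X]
    [NormedAddCommGroup Y] [NormedSpace ℝ Y] [CompleteSpace Y]
    [NormedAddCommGroup Z] [NormedSpace ℝ Z] [CompleteSpace Z]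
    (G : X × Y → Z) (x₀ : X) (y₀ : Y) (U : Set (X × Y)) (hU : U ∈ 𝓝 (x₀, y₀))
    (hG : ContDiffOn ℝ ∞ G U) (h0 : G (x₀, y₀) = 0) (L : Y ≃L[ℝ] Z)
    (hL : (fderiv ℝ G (x₀, y₀)).comp (ContinuousLinearMap.inr ℝ X Y) = (L : Y →L[ℝ] Z)) :
    ∃ ε > (0 : ℝ), ∃ δ > (0 : ℝ), ∃ γ : X → Y, ContDiffOn ℝ ∞ γ (Metric.ball x₀ ε) ∧ γ x₀ = y₀ ∧
      (∀ x ∈ Metric.ball x₀ ε, γ x ∈ Metric.ball y₀ δ) ∧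
      (∀ x ∈ Metric.ball x₀ ε, G (x, γ x) = 0) ∧
      (∀ x ∈ Metric.ball x₀ ε, ∀ y ∈ Metric.ball y₀ δ, G (x, y) = 0 → y = γ x) := by
  obtain ⟨ε, hε, δ, hδ, γ, hγs, hγ₀, hγδ, hγz, hγu, -, -⟩ :=
    exists_smooth_implicitFunction_of_contDiffOn' G x₀ y₀ U hU hG h0 L hL
  exact ⟨ε, hε, δ, hδ, γ, hγs, hγ₀, hγδ, hγz, hγu⟩

/-- **Smooth implicit function theorem with uniqueness, smoothness at the points of an open set
(full form).** Variant of `exists_smooth_implicitFunction_of_contDiffOn'` in which `G` is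
assumed `C^∞` at every point of an open set `U ∋ (x₀, y₀)`; same seven conclusions
(smoothness of `γ` on `ball x₀ ε`, `γ x₀ = y₀`, `γ (ball x₀ ε) ⊆ ball y₀ δ`, zeros, uniqueness
in the box, `ball x₀ ε ×ˢ ball y₀ δ ⊆ U`, `Dγ(x₀) = -L⁻¹ ∘ D₁G(x₀, y₀)`).
[cite: Dieudonne1960, Ch. X §2 (10.2.1)–(10.2.3)] -/
theorem exists_smooth_implicitFunction_of_contDiffAt' {X Y Z : Type*} [NormedAddCommGroup X]
    [NormedSpace ℝ X] [CompleteSpace X]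
    [NormedAddCommGroup Y] [NormedSpace ℝ Y] [CompleteSpace Y]
    [NormedAddCommGroup Z] [NormedSpace ℝ Z] [CompleteSpace Z]
    (G : X × Y → Z) (x₀ : X) (y₀ : Y) (U : Set (X × Y)) (hUo : IsOpen U) (hU : (x₀, y₀) ∈ U)
    (hG : ∀ q ∈ U, ContDiffAt ℝ ∞ G q) (h0 : G (x₀, y₀) = 0) (L : Y ≃L[ℝ] Z)
    (hL : (fderiv ℝ G (x₀, y₀)).comp (ContinuousLinearMap.inr ℝ X Y) = (L : Y →L[ℝ] Z)) :
    ∃ ε > (0 : ℝ), ∃ δ > (0 : ℝ), ∃ γ : X → Y, ContDiffOn ℝ ∞ γ (Metric.ball x₀ ε) ∧ γ x₀ = y₀ ∧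
      (∀ x ∈ Metric.ball x₀ ε, γ x ∈ Metric.ball y₀ δ) ∧
      (∀ x ∈ Metric.ball x₀ ε, G (x, γ x) = 0) ∧
      (∀ x ∈ Metric.ball x₀ ε, ∀ y ∈ Metric.ball y₀ δ, G (x, y) = 0 → y = γ x) ∧
      Metric.ball x₀ ε ×ˢ Metric.ball y₀ δ ⊆ U ∧
      HasFDerivAt γ (-(L.symm : Z →L[ℝ] Y) ∘L
        ((fderiv ℝ G (x₀, y₀)).comp (ContinuousLinearMap.inl ℝ X Y))) x₀ :=
  exists_smooth_implicitFunction_of_contDiffOn' G x₀ y₀ U (hUo.mem_nhds hU)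
    (fun q hq ↦ (hG q hq).contDiffWithinAt) h0 L hL

/-- **Smooth implicit function theorem with uniqueness, smoothness at the points of an open
set.** Variant of `exists_smooth_implicitFunction_of_contDiffOn` in which `G` is assumed `C^∞`
at every point of an open set `U ∋ (x₀, y₀)`: there are `ε, δ > 0` and `γ : X → Y`, `C^∞` on
`ball x₀ ε`, with `γ x₀ = y₀`, `γ (ball x₀ ε) ⊆ ball y₀ δ`, `G (x, γ x) = 0` on `ball x₀ ε`, and
uniqueness of the zeros of `G` in `ball x₀ ε ×ˢ ball y₀ δ`.
[cite: Dieudonne1960, Ch. X §2 (10.2.1)–(10.2.3)] -/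
theorem exists_smooth_implicitFunction_of_contDiffAt {X Y Z : Type*} [NormedAddCommGroup X]
    [NormedSpace ℝ X] [CompleteSpace X]
    [NormedAddCommGroup Y] [NormedSpace ℝ Y] [CompleteSpace Y]
    [NormedAddCommGroup Z] [NormedSpace ℝ Z] [CompleteSpace Z]
    (G : X × Y → Z) (x₀ : X) (y₀ : Y) (U : Set (X × Y)) (hUo : IsOpen U) (hU : (x₀, y₀) ∈ U)
    (hG : ∀ q ∈ U, ContDiffAt ℝ ∞ G q) (h0 : G (x₀, y₀) = 0) (L : Y ≃L[ℝ] Z)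
    (hL : (fderiv ℝ G (x₀, y₀)).comp (ContinuousLinearMap.inr ℝ X Y) = (L : Y →L[ℝ] Z)) :
    ∃ ε > (0 : ℝ), ∃ δ > (0 : ℝ), ∃ γ : X → Y, ContDiffOn ℝ ∞ γ (Metric.ball x₀ ε) ∧ γ x₀ = y₀ ∧
      (∀ x ∈ Metric.ball x₀ ε, γ x ∈ Metric.ball y₀ δ) ∧
      (∀ x ∈ Metric.ball x₀ ε, G (x, γ x) = 0) ∧
      (∀ x ∈ Metric.ball x₀ ε, ∀ y ∈ Metric.ball y₀ δ, G (x, y) = 0 → y = γ x) :=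
  exists_smooth_implicitFunction_of_contDiffOn G x₀ y₀ U (hUo.mem_nhds hU)
    (fun q hq ↦ (hG q hq).contDiffWithinAt) h0 L hL

/-- **Smooth implicit function theorem with uniqueness, smoothness on a ball (full form).**
Variant of `exists_smooth_implicitFunction_of_contDiffOn'` with `G` of class `C^∞` on the ball
`ball (x₀, y₀) ρ` (`ρ > 0`, sup metric on `X × Y`); same seven conclusions, the localisation
reading `ball x₀ ε ×ˢ ball y₀ δ ⊆ ball (x₀, y₀) ρ`.
[cite: Dieudonne1960, Ch. X §2 (10.2.1)–(10.2.3)] -/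
theorem exists_smooth_implicitFunction_of_contDiffOn_ball' {X Y Z : Type*}
    [NormedAddCommGroup X] [NormedSpace ℝ X] [CompleteSpace X]
    [NormedAddCommGroup Y] [NormedSpace ℝ Y] [CompleteSpace Y]
    [NormedAddCommGroup Z] [NormedSpace ℝ Z] [CompleteSpace Z]
    (G : X × Y → Z) (x₀ : X) (y₀ : Y) (ρ : ℝ) (hρ : 0 < ρ)
    (hG : ContDiffOn ℝ ∞ G (Metric.ball (x₀, y₀) ρ)) (h0 : G (x₀, y₀) = 0) (L : Y ≃L[ℝ] Z)
    (hL : (fderiv ℝ G (x₀, y₀)).comp (ContinuousLinearMap.inr ℝ X Y) = (L : Y →L[ℝ] Z)) :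
    ∃ ε > (0 : ℝ), ∃ δ > (0 : ℝ), ∃ γ : X → Y, ContDiffOn ℝ ∞ γ (Metric.ball x₀ ε) ∧ γ x₀ = y₀ ∧
      (∀ x ∈ Metric.ball x₀ ε, γ x ∈ Metric.ball y₀ δ) ∧
      (∀ x ∈ Metric.ball x₀ ε, G (x, γ x) = 0) ∧
      (∀ x ∈ Metric.ball x₀ ε, ∀ y ∈ Metric.ball y₀ δ, G (x, y) = 0 → y = γ x) ∧
      Metric.ball x₀ ε ×ˢ Metric.ball y₀ δ ⊆ Metric.ball (x₀, y₀) ρ ∧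
      HasFDerivAt γ (-(L.symm : Z →L[ℝ] Y) ∘L
        ((fderiv ℝ G (x₀, y₀)).comp (ContinuousLinearMap.inl ℝ X Y))) x₀ :=
  exists_smooth_implicitFunction_of_contDiffOn' G x₀ y₀ _ (ball_mem_nhds _ hρ) hG h0 L hL

/-- **Smooth implicit function theorem with uniqueness, smoothness on a ball.** Variant of
`exists_smooth_implicitFunction_of_contDiffOn` with `G` of class `C^∞` on the ball
`ball (x₀, y₀) ρ` (`ρ > 0`, sup metric on `X × Y`): there are `ε, δ > 0` and `γ : X → Y`, `C^∞`
on `ball x₀ ε`, with `γ x₀ = y₀`, `γ (ball x₀ ε) ⊆ ball y₀ δ`, `G (x, γ x) = 0` on `ball x₀ ε`,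
and uniqueness of the zeros of `G` in `ball x₀ ε ×ˢ ball y₀ δ`.
[cite: Dieudonne1960, Ch. X §2 (10.2.1)–(10.2.3)] -/
theorem exists_smooth_implicitFunction_of_contDiffOn_ball {X Y Z : Type*}
    [NormedAddCommGroup X] [NormedSpace ℝ X] [CompleteSpace X]
    [NormedAddCommGroup Y] [NormedSpace ℝ Y] [CompleteSpace Y]
    [NormedAddCommGroup Z] [NormedSpace ℝ Z] [CompleteSpace Z]
    (G : X × Y → Z) (x₀ : X) (y₀ : Y) (ρ : ℝ) (hρ : 0 < ρ)
    (hG : ContDiffOn ℝ ∞ G (Metric.ball (x₀, y₀) ρ)) (h0 : G (x₀, y₀) = 0) (L : Y ≃L[ℝ] Z)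
    (hL : (fderiv ℝ G (x₀, y₀)).comp (ContinuousLinearMap.inr ℝ X Y) = (L : Y →L[ℝ] Z)) :
    ∃ ε > (0 : ℝ), ∃ δ > (0 : ℝ), ∃ γ : X → Y, ContDiffOn ℝ ∞ γ (Metric.ball x₀ ε) ∧ γ x₀ = y₀ ∧
      (∀ x ∈ Metric.ball x₀ ε, γ x ∈ Metric.ball y₀ δ) ∧
      (∀ x ∈ Metric.ball x₀ ε, G (x, γ x) = 0) ∧
      (∀ x ∈ Metric.ball x₀ ε, ∀ y ∈ Metric.ball y₀ δ, G (x, y) = 0 → y = γ x) :=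
  exists_smooth_implicitFunction_of_contDiffOn G x₀ y₀ _ (ball_mem_nhds _ hρ) hG h0 L hL

/-- **Smooth implicit function theorem with uniqueness and the derivative of the implicit
function, global smoothness hypothesis.** The global theorem `exists_smooth_implicitFunction`
(`G` of class `C^∞` on all of `X × Y`) with the additional conclusion
`Dγ(x₀) = -L⁻¹ ∘ D₁G(x₀, y₀)`.
[cite: Dieudonne1960, Ch. X §2 (10.2.1)–(10.2.3)] -/
theorem exists_smooth_implicitFunction_hasFDerivAt {X Y Z : Type*} [NormedAddCommGroup X]
    [NormedSpace ℝ X] [CompleteSpace X]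
    [NormedAddCommGroup Y] [NormedSpace ℝ Y] [CompleteSpace Y]
    [NormedAddCommGroup Z] [NormedSpace ℝ Z] [CompleteSpace Z]
    (G : X × Y → Z) (hG : ContDiff ℝ ∞ G) (x₀ : X) (y₀ : Y) (h0 : G (x₀, y₀) = 0)
    (L : Y ≃L[ℝ] Z)
    (hL : (fderiv ℝ G (x₀, y₀)).comp (ContinuousLinearMap.inr ℝ X Y) = (L : Y →L[ℝ] Z)) :
    ∃ ε > (0 : ℝ), ∃ δ > (0 : ℝ), ∃ γ : X → Y, ContDiffOn ℝ ∞ γ (Metric.ball x₀ ε) ∧ γ x₀ = y₀ ∧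
      (∀ x ∈ Metric.ball x₀ ε, γ x ∈ Metric.ball y₀ δ) ∧
      (∀ x ∈ Metric.ball x₀ ε, G (x, γ x) = 0) ∧
      (∀ x ∈ Metric.ball x₀ ε, ∀ y ∈ Metric.ball y₀ δ, G (x, y) = 0 → y = γ x) ∧
      HasFDerivAt γ (-(L.symm : Z →L[ℝ] Y) ∘L
        ((fderiv ℝ G (x₀, y₀)).comp (ContinuousLinearMap.inl ℝ X Y))) x₀ := by
  obtain ⟨ε, hε, δ, hδ, γ, hγs, hγ₀, hγδ, hγz, hγu, -, hγd⟩ :=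
    exists_smooth_implicitFunction_of_contDiffOn' G x₀ y₀ univ univ_mem hG.contDiffOn h0 L hL
  exact ⟨ε, hε, δ, hδ, γ, hγs, hγ₀, hγδ, hγz, hγu, hγd⟩

end Literature.Analysis.Calculus

end
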